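import Summits.QuantumFields.YangMills.Theorems.BalabanUVNodesK0FlatCubeOpsTextP
import HarnessLib

/-!
# K0⁷ `stub_prop8StepCoP13` (stmt-QuantumFields-20541), sub-target S5, S5 ROAD item (b) — the d-generic port, file P3:
# **THE `H`-ROWS OF `K0FlatCubeOpsTextP.RowsAt` FROM KERNEL ROWS OF THE SHAPE OF [Balaban1984PropagatorsII] COR. 2.8 (2.150)–(2.151) AND [Balaban1985Variational]
# (130)∕(139)–(140), BY LINEARITY AND THE (162) ROW SUM — CARRIER-GENERIC TWIN of ym3-torus's `UnitScaleTiltProp8FlatOpsHRowsFromKernels`** (`(P : Params) (k : ℕ)`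
# for `(F : T3Family) (n K : ℕ)`, directions `Fin P.d`; proofs VERBATIM after the substitution; the carrier-free §1 of the UST file — `apply_eq_sum_indicator`,
# `exists_indicator` — and `exp_le_rowSummand` are consumed BY NAME)

Cell `pub-ymgap`, width seat `pub-ymgap-k0-s1-w3` gen 2 (D-0149; START LIST v7 §k0-s1 S5 ROAD item (b), plan g80 WORDS-1b l.25728).  `--kind proof --supports
stmt-QuantumFields-20541 --as helper`; count-neutral; def-free.

THE PRINT.  [Balaban1984PropagatorsII] Cor. 2.8 p. 249: *«|H(b,c)|, |(∇H)(b,c)| ≦ O(1)[1, (Lʲη)⁻¹](L^{j′}η)^{−d}e^{−δ₅d(y,c₋)}, b ∈ Δ(y), y ∈ Λ_j, c₋ ∈ Λ_{j′}»*;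
[Balaban1985Variational] (130) p. 298: *«|(Δ_{U₀}H₀)(x, y′)| ≦ B₀(Lʲη)^{−3}(L^{j′}η)^{−d}e^{−δ₀d(y,y′)}»*, (139)–(140) p. 299 (the `D*D` row); (161)₁ p. 303: *«|HB|, |∇^ηHB|,
|∂^{η*}∂^ηHB|, |Δ^ηHB| ≦ B₀Σ_{c∈ℭ_k}e^{−δ₀d(y₁,c₋)}(L^{j(c)}η)⁻¹|B(c)|»* = the kernel rows summed against the data (linearity); (46) p. 285 = the kernel rows summed with (162).

WHAT IS PROVED (sorry-free; axioms standard; every nested family `D : Domains P` at ANY carrier `P : Params`, height `k` with `D.k = k`, level weights `w`, a distance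
`dBI`, a plain-function `H`): `levBase_bounds` · `abs_data_le` · **`hDecayLetterD_of_kernelRows`** (`HKernelRows … C δ ⇒ HDecayLetterD … C δ`) · **`hSupLetterG_of_kernelRows`**,
**`hLapLetterG_of_kernelRows`** (`HKernelRows … C δ` + `RowSum162 … δ₀ B₃`, `δ ≥ δ₀∕2`, `dBI ≥ 0` ⇒ (46) `HSupLetterG … (C·B₃)` and (130) `HLapLetterG … (C·B₃)`) ·
**`hRows_of_kernelRows`** (the whole `H`-half `HRowsAt`-shape from `HKernelRows` for the canonical `flatH` + `RowSum162` + the comparator `distBI ≤ dBI`).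
HONEST SCOPE: finite sums and linearity; no estimate proved; count-neutral; K0⁷ OPEN; N07 NOT discharged (5∕27 unmoved); R4 closes the conditional finite-𝕋⁴ rung
`BalabanLadder.UV` only — the YM mass gap (Clay) is NOT proved by any of this; nothing continuum ∕ ℝ⁴ ∕ OS.

References: T. Bałaban, CMP **96** (1984) 223–250 [Balaban1984PropagatorsII] Cor. 2.8 (2.150)–(2.151) p.249, Lemma 2.1 (2.60)–(2.63) p.234; CMP **102** (1985) 277–309
[Balaban1985Variational] (46) p.285, (130) p.298, (139)–(140) p.299, (161)–(162) p.303.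
-/

set_option autoImplicit false

noncomputable section

open scoped BigOperators

namespace Summit.QuantumFields.YangMills.Theorems.K0FlatOpsHRowsFromKernelsP

open Literature.MathematicalPhysics.QuantumFieldTheory.Balaban1983to89
open B6SectADomainsV1 (Domains)
open B6SectAOperatorsV1 (BondIdx dcE dcsE)
open B11Eq115Space (levOf)
open Summit.QuantumFields.YangMills.Theorems.FlatOpsHRowsFromKernels (apply_eq_sum_indicator exists_indicator exp_le_rowSummand)
open Summit.QuantumFields.YangMills.Theorems.FlatCubeOpsText (distBI)
open Summit.QuantumFields.YangMills.Theorems.K0FlatCubeOpsTextP (IsLevWeight HSupLetterG HDecayLetterD RowSum162 flatH HLapLetterG HKernelRows HRowsAt)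

/-! ## §3 From kernel rows to the letters of the text -/

section Derive

variable {P : Params} {k : ℕ} {D : Domains P} {w : ℕ → PBond P 0 → ℝ}
variable {dBI : PBond P 0 → BondIdx D → ℝ} {H : (BondIdx D → ℝ) →ₗ[ℝ] (PBond P 0 → ℝ)} {C δ : ℝ}

/-- the level base `β(b) = L^{j(b)}·L^{−(K−n)}` of the weights: `w m b = β(b)^m`, `0 ≤ β(b) ≤ 1` (as `j(b) ≤ K − n`). [cite: Balaban1985Variational, p.286, (115) p.294] -/
theorem levBase_bounds (hw : IsLevWeight P k D w) (b : PBond P 0) :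
    0 ≤ w 1 b ∧ w 1 b ≤ 1 ∧ w 2 b = w 1 b * w 1 b ∧ w 3 b = w 1 b * w 2 b := by
  have hL1 : (1 : ℝ) ≤ (P.L : ℝ) := by exact_mod_cast P.hL.2.le
  have hL0 : (0 : ℝ) < (P.L : ℝ) := lt_of_lt_of_le zero_lt_one hL1
  have hlev : levOf (fun j => {x : Site P 0 | D.InOm j x}) k b.src ≤ k := B11Eq115Space.levOf_le _ _ _
  refine ⟨?_, ?_, ?_, ?_⟩
  · rw [hw 1 b]; positivity
  · rw [hw 1 b, pow_one, inv_pow, ← div_eq_mul_inv, div_le_one (pow_pos hL0 _)]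
    exact pow_le_pow_right₀ hL1 hlev
  · rw [hw 2 b, hw 1 b]; ring
  · rw [hw 3 b, hw 1 b, hw 2 b]; ring

/-- the data size `(L^{j(c)}η)|X(c)| ≤ t` in the form `|X(c)| ≤ t·L^{(K−n)−j(c)}`. [cite: Balaban1985Variational, (46) p.285, (162) p.303] -/
theorem abs_data_le (hDk : D.k = k) {X : BondIdx D → ℝ} {t : ℝ}
    (hX : ∀ c, ((P.L : ℝ) ^ ((c.1.1 : ℕ)) * ((P.L : ℝ)⁻¹) ^ k) * |X c| ≤ t) (c : BondIdx D) :
    |X c| ≤ t * (P.L : ℝ) ^ (k - (c.1.1 : ℕ)) := by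
  have hL0 : (0 : ℝ) < (P.L : ℝ) := by exact_mod_cast lt_trans zero_lt_one P.hL.2
  have hjc : (c.1.1 : ℕ) ≤ k := by
    have := Nat.lt_succ_iff.1 c.1.1.isLt
    omega
  have hωpos : 0 < (P.L : ℝ) ^ ((c.1.1 : ℕ)) * ((P.L : ℝ)⁻¹) ^ k := by positivity
  have hω : (P.L : ℝ) ^ ((c.1.1 : ℕ)) * ((P.L : ℝ)⁻¹) ^ k * (P.L : ℝ) ^ (k - (c.1.1 : ℕ)) = 1 := by
    rw [inv_pow, pow_sub₀ _ hL0.ne' hjc]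
    field_simp
  have h := hX c
  calc |X c| = ((P.L : ℝ) ^ ((c.1.1 : ℕ)) * ((P.L : ℝ)⁻¹) ^ k * |X c|) * (P.L : ℝ) ^ (k - (c.1.1 : ℕ)) := by
        rw [mul_comm _ |X c|, mul_assoc, hω, mul_one]
    _ ≤ t * (P.L : ℝ) ^ (k - (c.1.1 : ℕ)) := mul_le_mul_of_nonneg_right h (pow_nonneg hL0.le _)

/-- **(161)₁ FROM THE KERNEL ROWS** (linearity: `HX = Σ_c X(c)·He_c`; the left weights `(L^{j(b)}η)^m ≤ 1` absorb the extra powers).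
[cite: Balaban1985Variational, (161) p.303; Balaban1984PropagatorsII, Cor. 2.8 (2.150)-(2.151) p.249] -/
theorem hDecayLetterD_of_kernelRows (hw : IsLevWeight P k D w) (hk : HKernelRows P k D dBI w H C δ) :
    HDecayLetterD P k D dBI w H C δ := by
  intro X b
  obtain ⟨e, he, he'⟩ := exists_indicator (ι := BondIdx D)
  obtain ⟨hw0, hw1, hw2, hw3⟩ := levBase_bounds hw b
  have hE : ∀ b', H X b' = ∑ c, X c * H (e c) b' := fun b' => apply_eq_sum_indicator H e he he' X b'
  have hrow : ∀ c, 0 ≤ Real.exp (-(δ * dBI b c)) * |X c| := fun c => mul_nonneg (Real.exp_pos _).le (abs_nonneg _)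
  refine ⟨?_, fun ν => ?_, ?_, ?_⟩
  · -- row 1
    calc w 1 b * |H X b| ≤ 1 * |H X b| := mul_le_mul_of_nonneg_right hw1 (abs_nonneg _)
      _ = |∑ c, X c * H (e c) b| := by rw [one_mul, hE b]
      _ ≤ ∑ c, |X c * H (e c) b| := Finset.abs_sum_le_sum_abs _ _
      _ ≤ ∑ c, |X c| * (C * Real.exp (-(δ * dBI b c))) := Finset.sum_le_sum fun c _ => by
          rw [abs_mul]; exact mul_le_mul_of_nonneg_left ((hk c (e c) (he c) (he' c) b).1) (abs_nonneg _)
      _ = C * ∑ c, Real.exp (-(δ * dBI b c)) * |X c| := by rw [Finset.mul_sum]; exact Finset.sum_congr rfl fun c _ => by ring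
  · -- row 2
    have hdiff : H X ⟨b.src.shift ν, b.dir⟩ - H X b = ∑ c, X c * (H (e c) ⟨b.src.shift ν, b.dir⟩ - H (e c) b) := by
      rw [hE, hE, ← Finset.sum_sub_distrib]
      exact Finset.sum_congr rfl fun c _ => by ring
    rw [hdiff, hw2]
    calc w 1 b * w 1 b * (P.L : ℝ) ^ k * |∑ c, X c * (H (e c) ⟨b.src.shift ν, b.dir⟩ - H (e c) b)|
        ≤ w 1 b * w 1 b * (P.L : ℝ) ^ k * ∑ c, |X c * (H (e c) ⟨b.src.shift ν, b.dir⟩ - H (e c) b)| :=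
          mul_le_mul_of_nonneg_left (Finset.abs_sum_le_sum_abs _ _) (by positivity)
      _ = w 1 b * ∑ c, |X c| * (w 1 b * (P.L : ℝ) ^ k * |H (e c) ⟨b.src.shift ν, b.dir⟩ - H (e c) b|) := by
          rw [Finset.mul_sum, Finset.mul_sum]
          exact Finset.sum_congr rfl fun c _ => by rw [abs_mul]; ring
      _ ≤ 1 * ∑ c, |X c| * (C * Real.exp (-(δ * dBI b c))) := by
          refine mul_le_mul hw1 (Finset.sum_le_sum fun c _ => ?_) (Finset.sum_nonneg fun c _ => by positivity) zero_le_one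
          exact mul_le_mul_of_nonneg_left ((hk c (e c) (he c) (he' c) b).2.1 ν) (abs_nonneg _)
      _ = C * ∑ c, Real.exp (-(δ * dBI b c)) * |X c| := by rw [one_mul, Finset.mul_sum]; exact Finset.sum_congr rfl fun c _ => by ring
  · -- row 3: `X ↦ (∂*∂ (HX))(b)` is linear; expand it against the indicators
    set T : (BondIdx D → ℝ) →ₗ[ℝ] (PBond P 0 → ℝ) :=
      (WithLp.linearEquiv 2 ℝ (PBond P 0 → ℝ)).toLinearMap ∘ₗ
        (dcsE (P := P) ((P.L : ℝ) ^ k) ∘ₗ dcE (P := P) ((P.L : ℝ) ^ k)) ∘ₗ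
        (WithLp.linearEquiv 2 ℝ (PBond P 0 → ℝ)).symm.toLinearMap ∘ₗ H with hT
    have hTapp : ∀ (Y : BondIdx D → ℝ) (b' : PBond P 0),
        (dcsE ((P.L : ℝ) ^ k) (dcE ((P.L : ℝ) ^ k) (WithLp.toLp 2 (H Y)))) b' = T Y b' := fun _ _ => rfl
    rw [hTapp, apply_eq_sum_indicator T e he he' X b]
    calc w 3 b * |∑ c, X c * T (e c) b| ≤ w 3 b * ∑ c, |X c * T (e c) b| :=
          mul_le_mul_of_nonneg_left (Finset.abs_sum_le_sum_abs _ _) (by rw [hw3, hw2]; positivity)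
      _ = ∑ c, |X c| * (w 3 b * |T (e c) b|) := by rw [Finset.mul_sum]; exact Finset.sum_congr rfl fun c _ => by rw [abs_mul]; ring
      _ ≤ ∑ c, |X c| * (C * Real.exp (-(δ * dBI b c))) := Finset.sum_le_sum fun c _ => by
          refine mul_le_mul_of_nonneg_left ?_ (abs_nonneg _)
          have h3 := (hk c (e c) (he c) (he' c) b).2.2.1
          rwa [hTapp] at h3
      _ = C * ∑ c, Real.exp (-(δ * dBI b c)) * |X c| := by rw [Finset.mul_sum]; exact Finset.sum_congr rfl fun c _ => by ring
  · -- row 4: the Laplacian stencil is linear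
    have hlap : ∑ ν : Fin P.d, ((H X b - H X ⟨b.src.shift ν, b.dir⟩) + (H X b - H X ⟨b.src.unshift ν, b.dir⟩)) =
        ∑ c, X c * ∑ ν : Fin P.d, ((H (e c) b - H (e c) ⟨b.src.shift ν, b.dir⟩) + (H (e c) b - H (e c) ⟨b.src.unshift ν, b.dir⟩)) := by
      simp only [hE, Finset.mul_sum, ← Finset.sum_sub_distrib, ← Finset.sum_add_distrib, ← mul_sub, ← mul_add]
      rw [Finset.sum_comm]
    rw [hlap, hw3]
    calc w 1 b * w 2 b * ((P.L : ℝ) ^ k) ^ 2 *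
          |∑ c, X c * ∑ ν : Fin P.d, ((H (e c) b - H (e c) ⟨b.src.shift ν, b.dir⟩) + (H (e c) b - H (e c) ⟨b.src.unshift ν, b.dir⟩))|
        ≤ w 1 b * w 2 b * ((P.L : ℝ) ^ k) ^ 2 *
          ∑ c, |X c * ∑ ν : Fin P.d, ((H (e c) b - H (e c) ⟨b.src.shift ν, b.dir⟩) + (H (e c) b - H (e c) ⟨b.src.unshift ν, b.dir⟩))| :=
          mul_le_mul_of_nonneg_left (Finset.abs_sum_le_sum_abs _ _) (by rw [hw2]; positivity)
      _ = w 1 b * ∑ c, |X c| * (w 2 b * ((P.L : ℝ) ^ k) ^ 2 *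
          |∑ ν : Fin P.d, ((H (e c) b - H (e c) ⟨b.src.shift ν, b.dir⟩) + (H (e c) b - H (e c) ⟨b.src.unshift ν, b.dir⟩))|) := by
          rw [Finset.mul_sum, Finset.mul_sum]
          exact Finset.sum_congr rfl fun c _ => by rw [abs_mul]; ring
      _ ≤ 1 * ∑ c, |X c| * (C * Real.exp (-(δ * dBI b c))) := by
          refine mul_le_mul hw1 (Finset.sum_le_sum fun c _ => ?_) (Finset.sum_nonneg fun c _ => by rw [hw2]; positivity) zero_le_one
          exact mul_le_mul_of_nonneg_left ((hk c (e c) (he c) (he' c) b).2.2.2) (abs_nonneg _)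
      _ = C * ∑ c, Real.exp (-(δ * dBI b c)) * |X c| := by rw [one_mul, Finset.mul_sum]; exact Finset.sum_congr rfl fun c _ => by ring

/-- **(46) FROM THE KERNEL ROWS AND (162)**: with data `(L^{j(c)}η)|X(c)| ≤ t` each kernel row gives `C·t·(L^{j(b)}η)·Σ_c e^{−δd}L^{(K−n)−j(c)}`, and the (162) row sum
(`RowSum162`, rate `δ₀/2 ≤ δ`, `dBI ≥ 0`) bounds that by `C·t·B₃`. [cite: Balaban1985Variational, (46) p.285, (162) p.303; Balaban1984PropagatorsII, Cor. 2.8 (2.150)-(2.151) p.249] -/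
theorem hSupLetterG_of_kernelRows (hw : IsLevWeight P k D w) (hDk : D.k = k) (hC : 0 ≤ C) {δ₀ B₃ : ℝ} (hδ : δ₀ / 2 ≤ δ)
    (hd0 : ∀ b c, 0 ≤ dBI b c) (hk : HKernelRows P k D dBI w H C δ) (hrow : RowSum162 P k D dBI w δ₀ B₃) :
    HSupLetterG P k D w H (C * B₃) := by
  intro X t ht hX
  obtain ⟨e, he, he'⟩ := exists_indicator (ι := BondIdx D)
  have hE : ∀ b', H X b' = ∑ c, X c * H (e c) b' := fun b' => apply_eq_sum_indicator H e he he' X b'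
  have hXc : ∀ c, |X c| ≤ t * (P.L : ℝ) ^ (k - (c.1.1 : ℕ)) := abs_data_le hDk hX
  have hL0 : (0 : ℝ) ≤ (P.L : ℝ) := Nat.cast_nonneg _
  -- the per-term bound `|X c|·C·e^{−δd} ≤ C·t·(e^{−½δ₀d}(d+1)L^{(K−n)−j(c)})`
  have hterm : ∀ b c, |X c| * (C * Real.exp (-(δ * dBI b c))) ≤
      C * t * (Real.exp (-(δ₀ / 2 * dBI b c)) * (dBI b c + 1) * (P.L : ℝ) ^ (k - (c.1.1 : ℕ))) := by
    intro b c
    calc |X c| * (C * Real.exp (-(δ * dBI b c)))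
        ≤ (t * (P.L : ℝ) ^ (k - (c.1.1 : ℕ))) * (C * (Real.exp (-(δ₀ / 2 * dBI b c)) * (dBI b c + 1))) :=
          mul_le_mul (hXc c) (mul_le_mul_of_nonneg_left (exp_le_rowSummand hδ (hd0 b c)) hC) (by positivity) (by positivity)
      _ = C * t * (Real.exp (-(δ₀ / 2 * dBI b c)) * (dBI b c + 1) * (P.L : ℝ) ^ (k - (c.1.1 : ℕ))) := by ring
  refine ⟨fun b => ?_, fun b ν => ?_⟩
  · obtain ⟨hw0, hw1, -, -⟩ := levBase_bounds hw b
    calc w 1 b * |H X b| = w 1 b * |∑ c, X c * H (e c) b| := by rw [hE b]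
      _ ≤ w 1 b * ∑ c, |X c * H (e c) b| := mul_le_mul_of_nonneg_left (Finset.abs_sum_le_sum_abs _ _) hw0
      _ ≤ w 1 b * ∑ c, |X c| * (C * Real.exp (-(δ * dBI b c))) := mul_le_mul_of_nonneg_left
          (Finset.sum_le_sum fun c _ => by
            rw [abs_mul]; exact mul_le_mul_of_nonneg_left ((hk c (e c) (he c) (he' c) b).1) (abs_nonneg _)) hw0
      _ ≤ w 1 b * ∑ c, C * t * (Real.exp (-(δ₀ / 2 * dBI b c)) * (dBI b c + 1) * (P.L : ℝ) ^ (k - (c.1.1 : ℕ))) :=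
          mul_le_mul_of_nonneg_left (Finset.sum_le_sum fun c _ => hterm b c) hw0
      _ = C * t * (w 1 b * ∑ c, Real.exp (-(δ₀ / 2 * dBI b c)) * (dBI b c + 1) * (P.L : ℝ) ^ (k - (c.1.1 : ℕ))) := by
          rw [← Finset.mul_sum]; ring
      _ ≤ C * t * B₃ := mul_le_mul_of_nonneg_left (hrow b) (mul_nonneg hC ht)
      _ = C * B₃ * t := by ring
  · obtain ⟨hw0, hw1, hw2, -⟩ := levBase_bounds hw b
    have hdiff : H X ⟨b.src.shift ν, b.dir⟩ - H X b = ∑ c, X c * (H (e c) ⟨b.src.shift ν, b.dir⟩ - H (e c) b) := by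
      rw [hE, hE, ← Finset.sum_sub_distrib]
      exact Finset.sum_congr rfl fun c _ => by ring
    rw [hdiff, hw2]
    calc w 1 b * w 1 b * (P.L : ℝ) ^ k * |∑ c, X c * (H (e c) ⟨b.src.shift ν, b.dir⟩ - H (e c) b)|
        ≤ w 1 b * w 1 b * (P.L : ℝ) ^ k * ∑ c, |X c * (H (e c) ⟨b.src.shift ν, b.dir⟩ - H (e c) b)| :=
          mul_le_mul_of_nonneg_left (Finset.abs_sum_le_sum_abs _ _) (by positivity)
      _ = w 1 b * ∑ c, |X c| * (w 1 b * (P.L : ℝ) ^ k * |H (e c) ⟨b.src.shift ν, b.dir⟩ - H (e c) b|) := by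
          rw [Finset.mul_sum, Finset.mul_sum]
          exact Finset.sum_congr rfl fun c _ => by rw [abs_mul]; ring
      _ ≤ w 1 b * ∑ c, |X c| * (C * Real.exp (-(δ * dBI b c))) := mul_le_mul_of_nonneg_left
          (Finset.sum_le_sum fun c _ => mul_le_mul_of_nonneg_left ((hk c (e c) (he c) (he' c) b).2.1 ν) (abs_nonneg _)) hw0
      _ ≤ w 1 b * ∑ c, C * t * (Real.exp (-(δ₀ / 2 * dBI b c)) * (dBI b c + 1) * (P.L : ℝ) ^ (k - (c.1.1 : ℕ))) :=
          mul_le_mul_of_nonneg_left (Finset.sum_le_sum fun c _ => hterm b c) hw0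
      _ = C * t * (w 1 b * ∑ c, Real.exp (-(δ₀ / 2 * dBI b c)) * (dBI b c + 1) * (P.L : ℝ) ^ (k - (c.1.1 : ℕ))) := by
          rw [← Finset.mul_sum]; ring
      _ ≤ C * t * B₃ := mul_le_mul_of_nonneg_left (hrow b) (mul_nonneg hC ht)
      _ = C * B₃ * t := by ring

/-- **(130) — THE LAPLACIAN SUP ROW — FROM THE KERNEL ROW (k4) AND (162)**. [cite: Balaban1985Variational, (130) p.298, (162) p.303] -/
theorem hLapLetterG_of_kernelRows (hw : IsLevWeight P k D w) (hDk : D.k = k) (hC : 0 ≤ C) {δ₀ B₃ : ℝ} (hδ : δ₀ / 2 ≤ δ)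
    (hd0 : ∀ b c, 0 ≤ dBI b c) (hk : HKernelRows P k D dBI w H C δ) (hrow : RowSum162 P k D dBI w δ₀ B₃) :
    HLapLetterG P k D w H (C * B₃) := by
  intro X t ht hX b
  obtain ⟨e, he, he'⟩ := exists_indicator (ι := BondIdx D)
  have hE : ∀ b', H X b' = ∑ c, X c * H (e c) b' := fun b' => apply_eq_sum_indicator H e he he' X b'
  have hXc : ∀ c, |X c| ≤ t * (P.L : ℝ) ^ (k - (c.1.1 : ℕ)) := abs_data_le hDk hX
  have hL0 : (0 : ℝ) ≤ (P.L : ℝ) := Nat.cast_nonneg _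
  obtain ⟨hw0, hw1, hw2, hw3⟩ := levBase_bounds hw b
  have hterm : ∀ c, |X c| * (C * Real.exp (-(δ * dBI b c))) ≤
      C * t * (Real.exp (-(δ₀ / 2 * dBI b c)) * (dBI b c + 1) * (P.L : ℝ) ^ (k - (c.1.1 : ℕ))) := by
    intro c
    calc |X c| * (C * Real.exp (-(δ * dBI b c)))
        ≤ (t * (P.L : ℝ) ^ (k - (c.1.1 : ℕ))) * (C * (Real.exp (-(δ₀ / 2 * dBI b c)) * (dBI b c + 1))) :=
          mul_le_mul (hXc c) (mul_le_mul_of_nonneg_left (exp_le_rowSummand hδ (hd0 b c)) hC) (by positivity) (by positivity)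
      _ = C * t * (Real.exp (-(δ₀ / 2 * dBI b c)) * (dBI b c + 1) * (P.L : ℝ) ^ (k - (c.1.1 : ℕ))) := by ring
  have hlap : ∑ ν : Fin P.d, ((H X b - H X ⟨b.src.shift ν, b.dir⟩) + (H X b - H X ⟨b.src.unshift ν, b.dir⟩)) =
      ∑ c, X c * ∑ ν : Fin P.d, ((H (e c) b - H (e c) ⟨b.src.shift ν, b.dir⟩) + (H (e c) b - H (e c) ⟨b.src.unshift ν, b.dir⟩)) := by
    simp only [hE, Finset.mul_sum, ← Finset.sum_sub_distrib, ← Finset.sum_add_distrib, ← mul_sub, ← mul_add]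
    rw [Finset.sum_comm]
  rw [hlap, hw3]
  calc w 1 b * w 2 b * ((P.L : ℝ) ^ k) ^ 2 *
        |∑ c, X c * ∑ ν : Fin P.d, ((H (e c) b - H (e c) ⟨b.src.shift ν, b.dir⟩) + (H (e c) b - H (e c) ⟨b.src.unshift ν, b.dir⟩))|
      ≤ w 1 b * w 2 b * ((P.L : ℝ) ^ k) ^ 2 *
        ∑ c, |X c * ∑ ν : Fin P.d, ((H (e c) b - H (e c) ⟨b.src.shift ν, b.dir⟩) + (H (e c) b - H (e c) ⟨b.src.unshift ν, b.dir⟩))| :=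
        mul_le_mul_of_nonneg_left (Finset.abs_sum_le_sum_abs _ _) (by rw [hw2]; positivity)
    _ = w 1 b * ∑ c, |X c| * (w 2 b * ((P.L : ℝ) ^ k) ^ 2 *
        |∑ ν : Fin P.d, ((H (e c) b - H (e c) ⟨b.src.shift ν, b.dir⟩) + (H (e c) b - H (e c) ⟨b.src.unshift ν, b.dir⟩))|) := by
        rw [Finset.mul_sum, Finset.mul_sum]
        exact Finset.sum_congr rfl fun c _ => by rw [abs_mul]; ring
    _ ≤ w 1 b * ∑ c, |X c| * (C * Real.exp (-(δ * dBI b c))) := mul_le_mul_of_nonneg_left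
        (Finset.sum_le_sum fun c _ => mul_le_mul_of_nonneg_left ((hk c (e c) (he c) (he' c) b).2.2.2) (abs_nonneg _)) hw0
    _ ≤ w 1 b * ∑ c, C * t * (Real.exp (-(δ₀ / 2 * dBI b c)) * (dBI b c + 1) * (P.L : ℝ) ^ (k - (c.1.1 : ℕ))) :=
        mul_le_mul_of_nonneg_left (Finset.sum_le_sum fun c _ => hterm c) hw0
    _ = C * t * (w 1 b * ∑ c, Real.exp (-(δ₀ / 2 * dBI b c)) * (dBI b c + 1) * (P.L : ℝ) ^ (k - (c.1.1 : ℕ))) := by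
        rw [← Finset.mul_sum]; ring
    _ ≤ C * t * B₃ := mul_le_mul_of_nonneg_left (hrow b) (mul_nonneg hC ht)
    _ = C * B₃ * t := by ring

end Derive

/-! ## §4 The `H`-part of `RowsAt` from the kernel rows of the canonical `flatH` -/

section Pack

variable {P : Params} {k : ℕ} {D : Domains P} {w : ℕ → PBond P 0 → ℝ}

/-- **THE `H`-PART OF `RowsAt` (its first conjunct) FROM KERNEL ROWS + (162) + THE COMPARATOR**: `HKernelRows … dBI w flatH C δ`, `RowSum162 … dBI w δ₀ B₃` with
`δ₀/2 ≤ δ`, and `distBI ≤ dBI` give (46) `HSupLetterG` and (130) `HLapLetterG` at `max C (C·B₃)` and (161)₁ `HDecayLetterD` at `(max C (C·B₃), δ)` over that `dBI` —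
i.e. the three `H`-letters of `RowsAt P k D w (max C (C·B₃)) δ …` with the row sum read at the rate pair `(δ, B₃′)` the consumer chooses (here recorded with the
given `RowSum162 … δ₀ B₃`). [cite: Balaban1984PropagatorsII, Cor. 2.8 (2.150)-(2.151) p.249; Balaban1985Variational, (46) p.285, (130) p.298, (161)-(162) p.303] -/
theorem hRows_of_kernelRows (hw : IsLevWeight P k D w) (hDk : D.k = k) {dBI : PBond P 0 → BondIdx D → ℝ} {C δ δ₀ B₃ : ℝ}
    (hC : 0 ≤ C) (hδ : δ₀ / 2 ≤ δ) (hcomp : ∀ b c, distBI D b c ≤ dBI b c)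
    (hk : HKernelRows P k D dBI w (flatH P k D) C δ) (hrow : RowSum162 P k D dBI w δ₀ B₃) :
    HSupLetterG P k D w (flatH P k D) (max C (C * B₃)) ∧ HLapLetterG P k D w (flatH P k D) (max C (C * B₃)) ∧
      (∀ b c, distBI D b c ≤ dBI b c) ∧ RowSum162 P k D dBI w δ₀ B₃ ∧ HDecayLetterD P k D dBI w (flatH P k D) (max C (C * B₃)) δ := by
  have hd0 : ∀ b c, 0 ≤ dBI b c := fun b c => le_trans (by
    unfold distBI
    exact mul_nonneg (pow_nonneg (inv_nonneg.2 (Nat.cast_nonneg _)) _) (B5Prop12FieldsLattice.distSite_nonneg _ _)) (hcomp b c)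
  refine ⟨K0FlatCubeOpsTextP.hSupLetterG_mono (hSupLetterG_of_kernelRows hw hDk hC hδ hd0 hk hrow) (le_max_right _ _),
    K0FlatCubeOpsTextP.hLapLetterG_mono (hLapLetterG_of_kernelRows hw hDk hC hδ hd0 hk hrow) (le_max_right _ _), hcomp, hrow,
    K0FlatCubeOpsTextP.hDecayLetterD_mono (hDecayLetterD_of_kernelRows hw hk) (le_max_left _ _)⟩

end Pack

end Summit.QuantumFields.YangMills.Theorems.K0FlatOpsHRowsFromKernelsP

end
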